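import Summits.AtomisticToContinuum.Crystallization.Theorems.ThreeConeCertificateKeplerBoundLocLimMain
import Literature.MathematicalPhysics.StatisticalMechanics.CrystallizationLocalLimit

/-!
# `KeplerBound` (stmt-AtomisticToContinuum-11961) from local limits, IV: the Blanc–Lewin form of
# crystallization already implies the energetic conjunct

Support file for the item `ThreeConeCertificate.KeplerBound`.  MAIN RESULTS:

* `exists_isLocalLimit_of_isCrystallizing` — if Lennard-Jones in `ℝ³` crystallizes in the sense
  of Blanc–Lewin 2015 §2.1 (15)–(17) (`IsCrystallizing lennardJones 3`: translated subsequences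
  of ground states converge LOCALLY, as measures, to a periodic point measure `Σ m(s) δ_s`), then
  the carrying periodic configuration is a local limit of translated ground states in the sense
  of two-way matching on balls (`IsLocalLimitOfGroundStates`, the class `𝔏`): the uniform
  minimal distance of ground states (`LennardJonesMinimalDistance_holds`) forces `m ≡ 1`, the
  cone bumps at the finitely many sites in a ball give particles near every site, and a plateau
  test function counts the particles in the ball, leaving no room for a particle far from the
  sites.
* Hence, by part III (`keplerBound_of_isLocalLimit`): `IsCrystallizing lennardJones 3 →
  KeplerBound` (`keplerBound_of_isCrystallizing`), `→ HasPeriodicGroundStateEnergy lennardJones 3`,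
  and **`Crystallization ↔ IsCrystallizing lennardJones 3`** (`crystallization_iff_isCrystallizing`):
  conjunct (i) of the sub-problem is a CONSEQUENCE of conjunct (ii).

All `[folklore]` (Blanc–Lewin 2015, §2.2: local limits of uniformly separated minimisers are
multiplicity-free).
-/

noncomputable section

open scoped BigOperators Topology
open Filter Set Metric

namespace Summit.AtomisticToContinuum.Crystallization.Theorems.KeplerBoundLocalLimit

open Literature.MathematicalPhysics.StatisticalMechanics
open Summit.AtomisticToContinuum.Crystallization.Theorems.SlackRigidityNegative
  (E3 gs gs_isGroundState)
open Summit.AtomisticToContinuum.Crystallization.Theses.ThreeConeCertificate (KeplerBound)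

/-! ## § Two elementary facts about cone bumps -/

/-- A cone bump of radius `r ≥ 0` is bounded by `r`. [folklore] -/
theorem coneBump_le (c : E3) {r : ℝ} (hr : 0 ≤ r) (z : E3) : coneBump c r z ≤ r :=
  max_le hr (by linarith [dist_nonneg (x := z) (y := c)])

/-- Cone bumps are `1`-Lipschitz (one-sided form). [folklore] -/
theorem coneBump_sub_dist_le_coneBump (c : E3) (r : ℝ) (z s : E3) :
    coneBump c r s - dist z s ≤ coneBump c r z := by
  unfold coneBump
  have h1 : r - dist s c - dist z s ≤ r - dist z c := by linarith [dist_triangle z s c]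
  rcases le_total 0 (r - dist s c) with h | h
  · rw [max_eq_right h]
    exact le_trans (by linarith) (le_max_right _ _)
  · rw [max_eq_left h]
    linarith [le_max_left 0 (r - dist z c), dist_nonneg (x := z) (y := s)]

/-! ## § From local convergence of measures to two-way matching on balls -/

/-- **The Blanc–Lewin limit of Lennard-Jones ground states is a local limit in `𝔏`.** If
`IsCrystallizing lennardJones 3`, then some periodic configuration `P` of `ℝ³` has
`P.points ∈ 𝔏` (`IsLocalLimitOfGroundStates lennardJones 3 P.points`). [folklore] -/
theorem exists_isLocalLimit_of_isCrystallizing (h : IsCrystallizing lennardJones 3) :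
    ∃ P : PeriodicConfiguration 3, IsLocalLimitOfGroundStates lennardJones 3 P.points := by
  classical
  obtain ⟨δ, hδ, hsepall⟩ := LennardJonesMinimalDistance_holds
  obtain ⟨φ, τ, P, m, hφ, hm1, -, hlim⟩ := h gs gs_isGroundState
  refine ⟨P, gs, φ, τ, gs_isGroundState, hφ, fun R ε hε => ?_⟩
  set y : (j : ℕ) → Fin (φ j) → E3 := fun j i => gs (φ j) i + τ j with hy
  have hysep : ∀ j (i i' : Fin (φ j)), i ≠ i' → δ ≤ dist (y j i) (y j i') := fun j i i' hii' => by
    simp only [hy, dist_add_right]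
    exact hsepall _ _ (gs_isGroundState _) i i' hii'
  obtain ⟨ρ, hρ, hPsep⟩ := P.exists_pos_le_dist
  -- (1) multiplicities are `1`
  have hm_eq : ∀ s ∈ P.points, m s = 1 := by
    intro s hs
    refine le_antisymm ?_ (hm1 s hs)
    set r : ℝ := δ / 4 with hr
    have hrpos : 0 < r := by positivity
    have hl := hlim _ (coneBump.continuous s r) (coneBump.hasCompactSupport s r)
    have hbound : ∀ j, ∑ i, coneBump s r (y j i) ≤ r := by
      intro j
      by_cases hex : ∃ i, 0 < coneBump s r (y j i)
      · obtain ⟨i₀, hi₀⟩ := hex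
        have hd₀ := coneBump.dist_lt_of_pos s r hi₀
        have hzero : ∀ i ∈ Finset.univ.erase i₀, coneBump s r (y j i) = 0 := by
          intro i hi
          have hne : i ≠ i₀ := Finset.ne_of_mem_erase hi
          by_contra hne0
          have hpos : 0 < coneBump s r (y j i) := lt_of_le_of_ne (coneBump.nonneg s r _) (Ne.symm hne0)
          have hd := coneBump.dist_lt_of_pos s r hpos
          have h1 := hysep j i i₀ hne
          have h2 : dist (y j i) (y j i₀) ≤ dist (y j i) s + dist (y j i₀) s := dist_triangle_right _ _ _
          linarith
        rw [← Finset.add_sum_erase _ _ (Finset.mem_univ i₀), Finset.sum_eq_zero hzero, add_zero]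
        exact coneBump_le s hrpos.le _
      · push Not at hex
        have : ∑ i, coneBump s r (y j i) ≤ 0 := Finset.sum_nonpos fun i _ => hex i
        linarith
    have hge : (m s : ℝ) * r ≤ ∑' s' : P.points, (m s' : ℝ) * coneBump s r s' := by
      have := P.mul_le_tsum (coneBump.hasCompactSupport s r) (coneBump.nonneg s r) m hs
      rwa [coneBump.apply_self, max_eq_right hrpos.le] at this
    have hle : ∑' s' : P.points, (m s' : ℝ) * coneBump s r s' ≤ r :=
      le_of_tendsto' hl hbound
    have h1 : (m s : ℝ) * r ≤ 1 * r := by linarith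
    exact_mod_cast le_of_mul_le_mul_right h1 hrpos
  -- (2) every site eventually has a particle nearby
  have hnear : ∀ p ∈ P.points, ∀ ε' : ℝ, 0 < ε' → ∀ᶠ j in atTop, ∃ i, dist (y j i) p ≤ ε' := by
    intro p hp ε' hε'
    have hl := hlim _ (coneBump.continuous p ε') (coneBump.hasCompactSupport p ε')
    have hpos : (0 : ℝ) < ∑' s : P.points, (m s : ℝ) * coneBump p ε' s := by
      refine lt_of_lt_of_le ?_ (P.mul_le_tsum (coneBump.hasCompactSupport p ε')
        (coneBump.nonneg p ε') m hp)
      rw [coneBump.apply_self, max_eq_right hε'.le, hm_eq p hp]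
      simpa using hε'
    filter_upwards [hl.eventually (lt_mem_nhds hpos)] with j hj
    obtain ⟨i, -, hi⟩ := Finset.exists_lt_of_sum_lt
      (by simpa using hj : ∑ _i : Fin (φ j), (0 : ℝ) < ∑ i, coneBump p ε' (y j i))
    exact ⟨i, (coneBump.dist_lt_of_pos p ε' hi).le⟩
  -- (3) the finitely many sites in the balls of radii `R` and `R + 1`
  obtain ⟨T₁, hT₁⟩ := (P.finite_inter_points
    (isBounded_closedBall (x := (0 : E3)) (r := R))).exists_finset_coe
  obtain ⟨T₂, hT₂⟩ := (P.finite_inter_points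
    (isBounded_closedBall (x := (0 : E3)) (r := R + 1))).exists_finset_coe
  have hT₁mem : ∀ p, p ∈ T₁ ↔ ‖p‖ ≤ R ∧ p ∈ P.points := fun p => by
    rw [← Finset.mem_coe, hT₁, Set.mem_inter_iff, mem_closedBall_zero_iff]
  have hT₂mem : ∀ p, p ∈ T₂ ↔ ‖p‖ ≤ R + 1 ∧ p ∈ P.points := fun p => by
    rw [← Finset.mem_coe, hT₂, Set.mem_inter_iff, mem_closedBall_zero_iff]
  have hA : ∀ᶠ j in atTop, ∀ p ∈ T₁, ∃ i, dist (y j i) p ≤ ε :=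
    (Filter.eventually_all_finset T₁).2 fun p hp => hnear p ((hT₁mem p).1 hp).2 ε hε
  -- (4) the plateau test function `pl = min 1 (coneBump 0 (R+1))`
  set pl : E3 → ℝ := fun z => min 1 (coneBump 0 (R + 1) z) with hpl
  have hpl_cont : Continuous pl := continuous_const.min (coneBump.continuous 0 (R + 1))
  have hpl_nonneg : ∀ z, 0 ≤ pl z := fun z => le_min zero_le_one (coneBump.nonneg _ _ _)
  have hpl_support : Function.support pl ⊆ closedBall (0 : E3) (R + 1) := by
    intro z hz
    refine coneBump.support_subset 0 (R + 1) ?_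
    intro h0
    exact hz (by simp only [hpl, h0]; simp)
  have hpl_supp : HasCompactSupport pl :=
    HasCompactSupport.of_support_subset_isCompact (isCompact_closedBall 0 (R + 1)) hpl_support
  have hpl_tsupp : tsupport pl ⊆ closedBall (0 : E3) (R + 1) :=
    closure_minimal hpl_support isClosed_closedBall
  have hpl_one : ∀ z : E3, ‖z‖ ≤ R → pl z = 1 := fun z hz => by
    have : (1 : ℝ) ≤ coneBump 0 (R + 1) z := by
      refine le_trans ?_ (coneBump.sub_dist_le 0 (R + 1) z)
      rw [dist_zero_right]; linarith
    simp only [hpl]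
    exact min_eq_left this
  have hpl_lip : ∀ z s : E3, pl s - dist z s ≤ pl z := fun z s => by
    simp only [hpl]
    have h1 := coneBump_sub_dist_le_coneBump (0 : E3) (R + 1) z s
    have hd : 0 ≤ dist z s := dist_nonneg
    rcases le_total 1 (coneBump 0 (R + 1) z) with h | h
    · rw [min_eq_left h]
      linarith [min_le_left (1 : ℝ) (coneBump 0 (R + 1) s)]
    · rw [min_eq_right h]
      linarith [min_le_right (1 : ℝ) (coneBump 0 (R + 1) s)]
  -- its limit value
  set Λ₁ : ℝ := ∑ s ∈ T₂, pl s with hΛ₁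
  have hlimval : ∑' s : P.points, (m s : ℝ) * pl s = Λ₁ := by
    rw [P.tsum_mul_eq_sum hpl_tsupp m hT₂, hΛ₁]
    refine Finset.sum_congr rfl fun s hs => ?_
    rw [hm_eq s ((hT₂mem s).1 hs).2]
    simp
  have hC : ∀ᶠ j in atTop, ∑ i, pl (y j i) < Λ₁ + 1 / 2 := by
    have hl := hlim pl hpl_cont hpl_supp
    rw [hlimval] at hl
    exact hl.eventually (gt_mem_nhds (by linarith))
  -- the fine tolerance for the sites of `T₂`
  obtain ⟨ε'', hε'', hε''ε, hε''ρ, hε''c⟩ : ∃ ε'' : ℝ, 0 < ε'' ∧ ε'' ≤ ε ∧ 2 * ε'' < ρ ∧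
      (T₂.card : ℝ) * ε'' ≤ 1 / 4 := by
    refine ⟨min ε (min (ρ / 4) (1 / (4 * (T₂.card + 1)))), ?_, min_le_left _ _, ?_, ?_⟩
    · exact lt_min hε (lt_min (by positivity) (by positivity))
    · linarith [min_le_right ε (min (ρ / 4) (1 / (4 * (T₂.card + 1)))),
        min_le_left (ρ / 4) (1 / (4 * ((T₂.card : ℝ) + 1)))]
    · have h1 : min ε (min (ρ / 4) (1 / (4 * (T₂.card + 1)))) ≤ 1 / (4 * (T₂.card + 1)) :=
        (min_le_right _ _).trans (min_le_right _ _)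
      have h2 : (T₂.card : ℝ) * (1 / (4 * (T₂.card + 1))) ≤ 1 / 4 := by
        rw [mul_one_div, div_le_iff₀ (by positivity)]
        nlinarith [Nat.cast_nonneg (α := ℝ) T₂.card]
      exact (mul_le_mul_of_nonneg_left h1 (Nat.cast_nonneg _)).trans h2
  have hB : ∀ᶠ j in atTop, ∀ s ∈ T₂, ∃ i, dist (y j i) s ≤ ε'' :=
    (Filter.eventually_all_finset T₂).2 fun s hs => hnear s ((hT₂mem s).1 hs).2 ε'' hε''
  -- (5) conclusion
  filter_upwards [hA, hB, hC] with j hAj hBj hCj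
  refine ⟨fun p hp hpR => hAj p ((hT₁mem p).2 ⟨hpR, hp⟩), fun i hiR => ?_⟩
  by_contra hno
  push Not at hno
  haveI : Nonempty (Fin (φ j)) := ⟨i⟩
  choose! k hk using hBj
  have hkinj : Set.InjOn k ↑T₂ := by
    intro s hs s' hs' hss'
    by_contra hne
    have h1 := hPsep s ((hT₂mem s).1 hs).2 s' ((hT₂mem s').1 hs').2 hne
    have h2 : dist s s' ≤ dist (y j (k s)) s + dist (y j (k s')) s' := by
      rw [hss']; exact dist_triangle_left _ _ _
    linarith [hk s hs, hk s' hs']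
  have hki : i ∉ T₂.image k := by
    intro hmem
    obtain ⟨s, hs, hsk⟩ := Finset.mem_image.1 hmem
    have h1 := hk s hs
    rw [hsk] at h1
    have h2 := hno s ((hT₂mem s).1 hs).2
    linarith
  have hsub : ∑ i' ∈ insert i (T₂.image k), pl (y j i') ≤ ∑ i', pl (y j i') :=
    Finset.sum_le_sum_of_subset_of_nonneg (Finset.subset_univ _) fun i' _ _ => hpl_nonneg _
  rw [Finset.sum_insert hki, Finset.sum_image hkinj, hpl_one _ hiR] at hsub
  have hterms : ∑ s ∈ T₂, (pl s - ε'') ≤ ∑ s ∈ T₂, pl (y j (k s)) :=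
    Finset.sum_le_sum fun s hs => by linarith [hpl_lip (y j (k s)) s, hk s hs]
  rw [Finset.sum_sub_distrib, Finset.sum_const, nsmul_eq_mul] at hterms
  linarith

/-! ## § Consequences -/

/-- **`IsCrystallizing lennardJones 3 → KeplerBound`**: the Blanc–Lewin form of crystallization
already yields the route's energetic support item (through `𝔏`, part III). [folklore] -/
theorem keplerBound_of_isCrystallizing (h : IsCrystallizing lennardJones 3) : KeplerBound := by
  obtain ⟨P, hP⟩ := exists_isLocalLimit_of_isCrystallizing h
  exact keplerBound_of_isLocalLimit hP

/-- **Conjunct (ii) implies conjunct (i)**: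
`IsCrystallizing lennardJones 3 → HasPeriodicGroundStateEnergy lennardJones 3`. [folklore] -/
theorem hasPeriodicGroundStateEnergy_of_isCrystallizing (h : IsCrystallizing lennardJones 3) :
    HasPeriodicGroundStateEnergy lennardJones 3 :=
  keplerBound_iff_hasPeriodicGroundStateEnergy.1 (keplerBound_of_isCrystallizing h)

/-- **The sub-problem is its second conjunct**: `Crystallization ↔ IsCrystallizing lennardJones 3`.
[folklore] -/
theorem crystallization_iff_isCrystallizing :
    _root_.Crystallization ↔ IsCrystallizing lennardJones 3 :=
  ⟨fun h => h.2, fun h => ⟨hasPeriodicGroundStateEnergy_of_isCrystallizing h, h⟩⟩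

end Summit.AtomisticToContinuum.Crystallization.Theorems.KeplerBoundLocalLimit

end
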